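import Literature.Computability.AlgebraicComplexity.BI17PowerSumDegreeProofs
import Mathlib.Algebra.Polynomial.Derivative
import Mathlib.Algebra.Polynomial.Roots
import HarnessLib

/-!
# Bürgisser–Ikenmeyer 2017, Thm. 3.22 (`P_D` is nonzero iff `D` is odd) — discharge

P. Bürgisser, C. Ikenmeyer, *Fundamental invariants of orbit closures*, J. Algebra **477** (2017)
390–434 = arXiv:1511.02927 [BurgisserIkenmeyer2017], §3.2.1 "The case where `D = m` is odd",
Thm. 3.22 (`\label{th:explicit-invar-formsODD}`, `main.tex` L1266–1301; held text
`paper:arxiv-1511.02927`, p0011): "1. We have `P_D(gv) = (det g)^{D+1} P_D(v)` for all `g ∈ GL_D`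
and `v ∈ ⊗^D ℂ^D`. 2. The polynomial `P_D` is nonzero iff `D` is odd." Here `P_D` is the tableau
invariant (eq. (3.4)) of the cyclic `D × (D+1)` tableau, eq. (3.7) (L1261):
`P_D(v) = ∑_{σ_1,…,σ_{D+1} ∈ S_D} [∏_j sgn σ_j] ∏_{i=1}^{D+1} v(σ_i(1), σ_{i+1}(2), …, σ_{i+D-1}(D))`
(indices of `σ` mod `D + 1`), typed in the file of record `BI17FundamentalInvariantForms.lean`
(val-lit row BI17-A, t04) as `tableauInv (cyclicTableau D)` / `oddCayleyP`, with Thm. 3.22 the named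
fact `BI2017_thm_3_22` (part 1 already proved there, `BI2017_thm_3_22_1`). This theorem-only
companion proves part 2 and discharges the fact (`BI2017_thm_3_22_holds`).

## The two directions

* `D` odd ⇒ `P_D ≠ 0` — the printed proof (L1275–1300), followed: evaluate `P_D` at the form
  `w_α = α (X_1 + ⋯ + X_D)^D + X_1^D + ⋯ + X_D^D`, whose symmetric array is `α + [μ constant]`
  (the print has the two values `α`, `1` interchanged, which only relabels the coefficient that is
  analysed), and read off one coefficient of the resulting polynomial in `α`: the coefficient of
  `α^1` (the print's "coefficient of `α^D`") only sees the tuples `(σ_1,…,σ_{D+1})` for which `D` of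
  the `D + 1` column words `(σ_i(1), …, σ_{i+D-1}(D))` are constant ("there exists a cardinality `D`
  subset `I` … such that `σ_i(1) = ⋯ = σ_{i+D-1}(D)` for all `i ∈ I`", L1285). As in the print, such
  a tuple is determined by the index `ῑ` of the exceptional column and the one permutation `σ_ῑ`
  (L1290: "all `σ_i` are completely determined by `σ_ῑ`"): here `σ_j = σ_ῑ ∘ g_j` for FIXED
  permutations `g_j` (`baseSlotPerm`), so that the sign `∏_j sgn σ_j = sgn(σ_ῑ)^{D+1} ∏_j sgn g_j`
  does not depend on `σ_ῑ` because `D + 1` is even ("`(-1)^{D+1} = 1`, since `D+1` is even", L1298)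
  — we do not need the print's finer claim that all `σ_i` have the same sign. Hence the coefficient
  is `± (D+1) · D!`, nonzero. The coefficient is extracted algebraically as
  `(d/dα P_D(w_α))|_{α=0}` over `ℂ[α]` (`Polynomial.derivative_prod_finset`), and a nonzero
  polynomial in `α` has a non-root in `ℂ`.
* `D` even ⇒ `P_D = 0` (on `Sym^D ℂ^D`). The print proves only the first direction and leaves this
  one to Howe's Thm. 3.21 (`O(Sym^D ℂ^D)^{SL_D}_{D+1} = 0` for even `D`), which the tree holds only as
  the named fact `BI2017_thm_3_21`. We give instead an elementary sign-reversing bijection (not in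
  the source): every permutation `κ` of `ℤ/(D+1)` acts on the cells (row `j`, column `i ≠ j + 1`) of
  the cyclic tableau by `(j, i) ↦ (κ⁻¹ j, κ⁻¹(i − 1) + 1)`; transporting a tuple `σ` along it keeps
  every row a permutation (`σ'_{j} = σ_{κ j} ∘ θ_j` with the slot bijections `θ_j = cycSlotPerm κ j`),
  permutes the column words up to reordering their letters — invisible to a SYMMETRIC array — and
  multiplies `∏_j sgn σ_j` by `ε(κ) = ∏_j sgn θ_j`. For `κ` a transposition `(a b)`, `θ_j` is a
  transposition for the `D − 1` rows `j ∉ {a, b}` and `θ_b = θ_a⁻¹`, so `ε = (−1)^{D−1} = −1` when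
  `D` is even: `P_D|_{Sym} = −P_D|_{Sym}`, hence `0` in characteristic zero
  (`tableauInv_cyclicTableau_eq_zero_of_even`, any symmetric array over a characteristic-zero
  domain). (Checked numerically beforehand for `D = 2, 4`; for `D ≡ 2 (mod 4)` the slot reversal
  alone would do, for `D ≡ 0 (mod 4)` it would not.)

Main declarations: `cycColWord`, `cycSlotPerm`, `cycRelabel` (the action), `baseSlotPerm` (the
`g_j`), `tableauInv_cyclicTableau_eq_zero_of_even`, `oddCayleyP_eq_zero_of_even`,
`oddCayleyP_ne_zero_of_odd`, **`BI2017_thm_3_22_holds`** (the evaluation bridge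
`aeval_formCoeff_tableauInvPoly` is t01's, `BI17PowerSumDegreeProofs.lean`).
No definitions of mathematical notions beyond proof-local combinatorial gadgets (all `def`s below
are the bijections of the proof); no new facts. Honest framing: a statement about one explicit
`SL_D`-invariant of degree `D + 1` on `Sym^D ℂ^D`; nothing here bears on VP versus VNP.

## References

* [BurgisserIkenmeyer2017] P. Bürgisser, C. Ikenmeyer, *Fundamental invariants of orbit closures*,
  J. Algebra 477 (2017) 390–434; arXiv:1511.02927, §3.2.1, eq. (3.7) and Thm. 3.22.
-/

open MvPolynomial

namespace Literature.Computability.AlgebraicComplexity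

/-! ### Arithmetic in `ℤ/(D+1)` = `Fin (D + 1)` and the slots `Fin D` -/

section FinArith

open Fin.CommRing

variable {D : ℕ}

/-- `Fin.last D = -1` in the ring `Fin (D + 1)`. [folklore] -/
private theorem fin_last_eq_neg_one : (Fin.last D : Fin (D + 1)) = -1 := by
  have h := Fin.neg_last D
  rw [neg_eq_iff_eq_neg] at h
  exact h

/-- A slot `ι : Fin D`, viewed in `Fin (D + 1)`, is never `-1`. [folklore] -/
private theorem castSucc_ne_neg_one (ι : Fin D) : (Fin.castSucc ι : Fin (D + 1)) ≠ -1 := by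
  rw [← fin_last_eq_neg_one]
  exact Fin.castSucc_ne_last ι

/-- For `x ≠ y` in `Fin (D + 1)`, `x - y - 1` is not the last element `-1`. [folklore] -/
private theorem sub_sub_one_ne_last {x y : Fin (D + 1)} (h : x ≠ y) : x - y - 1 ≠ Fin.last D := by
  intro h'
  rw [fin_last_eq_neg_one] at h'
  exact h (sub_eq_zero.mp (by linear_combination h'))

end FinArith

/-! ### The column words of the cyclic tableau and the relabelling action -/

section CyclicAction

open Fin.CommRing

variable {D : ℕ}

/-- The cyclic tableau sends `(ι, i)` to `(ι, i + ι)`. [cite: BurgisserIkenmeyer2017, eq. (3.7)] -/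
@[simp] theorem cyclicTableau_apply (ι : Fin D) (i : Fin (D + 1)) :
    cyclicTableau D (ι, i) = (ι, i + Fin.castSucc ι) :=
  rfl

/-- The `i`-th **column word** of a tuple `σ = (σ_j)_{j ∈ ℤ/(D+1)}` of permutations of `[D]`:
`ι ↦ σ_{i+ι}(ι)` — the argument `(σ_i(1), σ_{i+1}(2), …, σ_{i+D-1}(D))` of the `i`-th factor of
eq. (3.7). [cite: BurgisserIkenmeyer2017, eq. (3.7)] -/
def cycColWord (σ : Fin (D + 1) → Equiv.Perm (Fin D)) (i : Fin (D + 1)) (ι : Fin D) : Fin D :=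
  σ (i + Fin.castSucc ι) ι

/-- `P_D` (the tableau invariant of the cyclic tableau) written with column words.
[cite: BurgisserIkenmeyer2017, eq. (3.7)] -/
theorem tableauInv_cyclicTableau {R : Type*} [CommRing R] (v : (Fin D → Fin D) → R) :
    tableauInv (cyclicTableau D) v =
      ∑ σ : Fin (D + 1) → Equiv.Perm (Fin D),
        (∏ j, (Equiv.Perm.sign (σ j) : R)) * ∏ i, v (cycColWord σ i) :=
  rfl

/-- The slot map of the relabelling by `κ`: new row `j'`, new slot `ι'` ↦ the old slot
`castPred (κ j' - κ (j' - ι' - 1) - 1)` (the cell of row `j'` with "partner" `j' - ι' - 1` goes to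
the cell of row `κ j'` with partner `κ (j' - ι' - 1)`); the device of our proof of the even
case of BI 2017 Thm. 3.22(2) (not in the source). [cite: BurgisserIkenmeyer2017, Thm. 3.22(2)] -/
def cycSlotFun (κ : Equiv.Perm (Fin (D + 1))) (j' : Fin (D + 1)) (ι' : Fin D) : Fin D :=
  Fin.castPred (κ j' - κ (j' - Fin.castSucc ι' - 1) - 1)
    (sub_sub_one_ne_last fun h => by
      have h1 : j' = j' - Fin.castSucc ι' - 1 := κ.injective h
      exact castSucc_ne_neg_one ι' (by linear_combination h1))

/-- The slot map, read in `Fin (D + 1)`. [folklore] -/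
private theorem castSucc_cycSlotFun (κ : Equiv.Perm (Fin (D + 1))) (j' : Fin (D + 1)) (ι' : Fin D) :
    Fin.castSucc (cycSlotFun κ j' ι') = κ j' - κ (j' - Fin.castSucc ι' - 1) - 1 :=
  Fin.castSucc_castPred _ _

/-- The slot map is injective. [folklore] -/
private theorem cycSlotFun_injective (κ : Equiv.Perm (Fin (D + 1))) (j' : Fin (D + 1)) :
    Function.Injective (cycSlotFun κ j') := by
  intro ι₁ ι₂ h
  have h1 := congrArg Fin.castSucc h
  rw [castSucc_cycSlotFun, castSucc_cycSlotFun] at h1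
  have h2 : κ (j' - Fin.castSucc ι₁ - 1) = κ (j' - Fin.castSucc ι₂ - 1) := by
    linear_combination -h1
  have h3 := κ.injective h2
  exact Fin.castSucc_injective _ (by linear_combination -h3)

/-- The slot bijection `θ_{j'}` of the relabelling by `κ` (a permutation of the slots `[D]`).
[cite: BurgisserIkenmeyer2017, Thm. 3.22(2)] -/
noncomputable def cycSlotPerm (κ : Equiv.Perm (Fin (D + 1))) (j' : Fin (D + 1)) :
    Equiv.Perm (Fin D) :=
  Equiv.ofBijective (cycSlotFun κ j')
    (Finite.injective_iff_bijective.mp (cycSlotFun_injective κ j'))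

/-- Unfolding `cycSlotPerm`. [folklore] -/
@[simp] private theorem cycSlotPerm_apply (κ : Equiv.Perm (Fin (D + 1))) (j' : Fin (D + 1)) (ι' : Fin D) :
    cycSlotPerm κ j' ι' = cycSlotFun κ j' ι' :=
  rfl

/-- **The relabelling action** of a permutation `κ` of `ℤ/(D+1)` on tuples
`σ = (σ_j)_{j ∈ ℤ/(D+1)}` of permutations of `[D]`: `(κ · σ)_{j'} = σ_{κ j'} ∘ θ_{j'}` (a
bijection on tuples; our device for the even case). [cite: BurgisserIkenmeyer2017, Thm. 3.22(2)] -/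
noncomputable def cycRelabel (κ : Equiv.Perm (Fin (D + 1))) :
    (Fin (D + 1) → Equiv.Perm (Fin D)) ≃ (Fin (D + 1) → Equiv.Perm (Fin D)) where
  toFun σ := fun j' => σ (κ j') * cycSlotPerm κ j'
  invFun σ := fun j => σ (κ.symm j) * (cycSlotPerm κ (κ.symm j))⁻¹
  left_inv σ := by
    funext j
    simp only [Equiv.apply_symm_apply, mul_inv_cancel_right]
  right_inv σ := by
    funext j'
    simp only [Equiv.symm_apply_apply, inv_mul_cancel_right]

/-- Unfolding `cycRelabel`. [folklore] -/
private theorem cycRelabel_apply (κ : Equiv.Perm (Fin (D + 1))) (σ : Fin (D + 1) → Equiv.Perm (Fin D))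
    (j' : Fin (D + 1)) : cycRelabel κ σ j' = σ (κ j') * cycSlotPerm κ j' :=
  rfl

/-- The column bijection of the relabelling: new column `i` comes from old column `κ (i-1) + 1`.
[cite: BurgisserIkenmeyer2017, Thm. 3.22(2)] -/
def cycColShift (κ : Equiv.Perm (Fin (D + 1))) : Equiv.Perm (Fin (D + 1)) :=
  (Equiv.subRight 1).trans (κ.trans (Equiv.addRight 1))

/-- Unfolding `cycColShift`. [folklore] -/
private theorem cycColShift_apply (κ : Equiv.Perm (Fin (D + 1))) (i : Fin (D + 1)) :
    cycColShift κ i = κ (i - 1) + 1 :=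
  rfl

/-- Within new column `i`, the letters are those of old column `κ (i-1) + 1`, reordered by this
injection of slots. [folklore] -/
private theorem cycColSlot_injective (κ : Equiv.Perm (Fin (D + 1))) (i : Fin (D + 1)) :
    Function.Injective fun ι : Fin D => cycSlotFun κ (i + Fin.castSucc ι) ι := by
  intro ι₁ ι₂ h
  have h1 := congrArg Fin.castSucc h
  simp only [castSucc_cycSlotFun] at h1
  have h2 : κ (i + Fin.castSucc ι₁) = κ (i + Fin.castSucc ι₂) := by
    have e1 : i + Fin.castSucc ι₁ - Fin.castSucc ι₁ - 1 = i - 1 := by ring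
    have e2 : i + Fin.castSucc ι₂ - Fin.castSucc ι₂ - 1 = i - 1 := by ring
    rw [e1, e2] at h1
    linear_combination h1
  have h3 := κ.injective h2
  exact Fin.castSucc_injective _ (by linear_combination h3)

/-- **Column words are permuted (up to reordering letters) by the relabelling**:
the `i`-th column word of `κ · σ` is the `(κ(i-1)+1)`-th column word of `σ` composed with a
bijection of the slots. [cite: BurgisserIkenmeyer2017, Thm. 3.22(2)] -/
theorem cycColWord_cycRelabel (κ : Equiv.Perm (Fin (D + 1)))
    (σ : Fin (D + 1) → Equiv.Perm (Fin D)) (i : Fin (D + 1)) :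
    cycColWord (cycRelabel κ σ) i =
      cycColWord σ (cycColShift κ i) ∘
        Equiv.ofBijective (fun ι : Fin D => cycSlotFun κ (i + Fin.castSucc ι) ι)
          (Finite.injective_iff_bijective.mp (cycColSlot_injective κ i)) := by
  funext ι
  simp only [cycColWord, cycRelabel_apply, Equiv.Perm.mul_apply, cycSlotPerm_apply,
    Function.comp_apply, Equiv.ofBijective_apply, cycColShift_apply]
  have hrow : κ (i - 1) + 1 + Fin.castSucc (cycSlotFun κ (i + Fin.castSucc ι) ι) =
      κ (i + Fin.castSucc ι) := by
    rw [castSucc_cycSlotFun]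
    have e1 : i + Fin.castSucc ι - Fin.castSucc ι - 1 = i - 1 := by ring
    rw [e1]
    ring
  rw [hrow]

/-- The sign multiplier `ε(κ) = ∏_{j'} sgn θ_{j'}` of the relabelling:
`∏_j sgn (κ · σ)_j = ε(κ) ∏_j sgn σ_j`. [cite: BurgisserIkenmeyer2017, Thm. 3.22(2)] -/
theorem prod_sign_cycRelabel {R : Type*} [CommRing R] (κ : Equiv.Perm (Fin (D + 1)))
    (σ : Fin (D + 1) → Equiv.Perm (Fin D)) :
    (∏ j', (Equiv.Perm.sign (cycRelabel κ σ j') : R)) =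
      (∏ j', (Equiv.Perm.sign (cycSlotPerm κ j') : R)) * ∏ j, (Equiv.Perm.sign (σ j) : R) := by
  have h1 : ∀ j', (Equiv.Perm.sign (cycRelabel κ σ j') : R) =
      (Equiv.Perm.sign (σ (κ j')) : R) * (Equiv.Perm.sign (cycSlotPerm κ j') : R) := by
    intro j'
    rw [cycRelabel_apply, map_mul, Units.val_mul, Int.cast_mul]
  simp_rw [h1]
  rw [Finset.prod_mul_distrib, mul_comm]
  congr 1
  exact Equiv.prod_comp κ (fun j => (Equiv.Perm.sign (σ j) : R))

/-- **Invariance of the unsigned part**: for a SYMMETRIC array `v`, the product of the values of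
`v` at the column words is unchanged by the relabelling. [cite: BurgisserIkenmeyer2017, Thm. 3.22(2)] -/
theorem prod_cycColWord_cycRelabel {R : Type*} [CommRing R] (v : (Fin D → Fin D) → R)
    (hv : ∀ (w : Fin D → Fin D) (e : Equiv.Perm (Fin D)), v (w ∘ e) = v w)
    (κ : Equiv.Perm (Fin (D + 1))) (σ : Fin (D + 1) → Equiv.Perm (Fin D)) :
    (∏ i, v (cycColWord (cycRelabel κ σ) i)) = ∏ i, v (cycColWord σ i) := by
  have h1 : ∀ i, v (cycColWord (cycRelabel κ σ) i) = v (cycColWord σ (cycColShift κ i)) := by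
    intro i
    rw [cycColWord_cycRelabel, hv]
  simp_rw [h1]
  exact Equiv.prod_comp (cycColShift κ) (fun i => v (cycColWord σ i))

/-- The relabelling multiplies `P_D` (on a symmetric array) by `ε(κ)`: `P_D(v) = ε(κ) P_D(v)`.
[cite: BurgisserIkenmeyer2017, Thm. 3.22(2)] -/
theorem tableauInv_cyclicTableau_eq_eps_mul {R : Type*} [CommRing R] (v : (Fin D → Fin D) → R)
    (hv : ∀ (w : Fin D → Fin D) (e : Equiv.Perm (Fin D)), v (w ∘ e) = v w)
    (κ : Equiv.Perm (Fin (D + 1))) :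
    tableauInv (cyclicTableau D) v =
      (∏ j', (Equiv.Perm.sign (cycSlotPerm κ j') : R)) * tableauInv (cyclicTableau D) v := by
  rw [tableauInv_cyclicTableau, Finset.mul_sum]
  conv_lhs => rw [← Equiv.sum_comp (cycRelabel κ)]
  refine Finset.sum_congr rfl fun σ _ => ?_
  rw [prod_sign_cycRelabel, prod_cycColWord_cycRelabel v hv, mul_assoc]

end CyclicAction

/-! ### The sign of a transposition relabelling: `ε((a b)) = (-1)^{D-1}` -/

section SwapSign

open Fin.CommRing

variable {D : ℕ}

/-- The slot of row `j` whose partner is `q ≠ j`: `castPred (j - q - 1)`. [cite: BurgisserIkenmeyer2017, Thm. 3.22(2)] -/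
def cycSlotOf (j q : Fin (D + 1)) (h : j ≠ q) : Fin D :=
  Fin.castPred (j - q - 1) (sub_sub_one_ne_last h)

/-- The partner slot, read in `Fin (D + 1)`. [folklore] -/
private theorem castSucc_cycSlotOf (j q : Fin (D + 1)) (h : j ≠ q) :
    Fin.castSucc (cycSlotOf j q h) = j - q - 1 :=
  Fin.castSucc_castPred _ _

/-- For a row `j ∉ {a, b}`, the slot map of the transposition `(a b)` is the transposition of the
two slots of row `j` with partners `a` and `b`. [cite: BurgisserIkenmeyer2017, Thm. 3.22(2)] -/
theorem cycSlotPerm_swap_of_ne {a b j : Fin (D + 1)} (hja : j ≠ a) (hjb : j ≠ b) :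
    cycSlotPerm (Equiv.swap a b) j = Equiv.swap (cycSlotOf j a hja) (cycSlotOf j b hjb) := by
  refine Equiv.ext fun ι => Fin.castSucc_injective _ ?_
  rw [cycSlotPerm_apply, castSucc_cycSlotFun, Equiv.swap_apply_of_ne_of_ne hja hjb]
  -- the partner `q = j - ι - 1` of the slot `ι`
  set q : Fin (D + 1) := j - Fin.castSucc ι - 1 with hq
  have hι : Fin.castSucc ι = j - q - 1 := by rw [hq]; ring
  by_cases hqa : q = a
  · have hιa : ι = cycSlotOf j a hja := by
      apply Fin.castSucc_injective
      rw [castSucc_cycSlotOf, hι, hqa]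
    rw [hqa, Equiv.swap_apply_left, hιa, Equiv.swap_apply_left, castSucc_cycSlotOf]
  by_cases hqb : q = b
  · have hιb : ι = cycSlotOf j b hjb := by
      apply Fin.castSucc_injective
      rw [castSucc_cycSlotOf, hι, hqb]
    rw [hqb, Equiv.swap_apply_right, hιb, Equiv.swap_apply_right, castSucc_cycSlotOf]
  · have hιa : ι ≠ cycSlotOf j a hja := by
      intro h
      apply hqa
      have h1 := congrArg Fin.castSucc h
      rw [castSucc_cycSlotOf, hι] at h1
      linear_combination -h1
    have hιb : ι ≠ cycSlotOf j b hjb := by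
      intro h
      apply hqb
      have h1 := congrArg Fin.castSucc h
      rw [castSucc_cycSlotOf, hι] at h1
      linear_combination -h1
    rw [Equiv.swap_apply_of_ne_of_ne hqa hqb, Equiv.swap_apply_of_ne_of_ne hιa hιb, hι]

/-- The slot maps of the transposition `(a b)` at the rows `a` and `b` are mutually inverse.
[cite: BurgisserIkenmeyer2017, Thm. 3.22(2)] -/
theorem cycSlotPerm_swap_mul (a b : Fin (D + 1)) :
    cycSlotPerm (Equiv.swap a b) a * cycSlotPerm (Equiv.swap a b) b = 1 := by
  refine Equiv.ext fun ι => Fin.castSucc_injective _ ?_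
  rw [Equiv.Perm.mul_apply, Equiv.Perm.one_apply, cycSlotPerm_apply, cycSlotPerm_apply,
    castSucc_cycSlotFun, Equiv.swap_apply_left]
  -- the value `y = θ_b ι`, through its image in `Fin (D+1)`
  set y : Fin D := cycSlotFun (Equiv.swap a b) b ι with hy
  have hyc : Fin.castSucc y = a - Equiv.swap a b (b - Fin.castSucc ι - 1) - 1 := by
    rw [hy, castSucc_cycSlotFun, Equiv.swap_apply_right]
  set q : Fin (D + 1) := b - Fin.castSucc ι - 1 with hq
  have hqb : q ≠ b := by
    intro h
    exact castSucc_ne_neg_one ι (by rw [hq] at h; linear_combination -h)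
  by_cases hqa : q = a
  · -- `ι` is the slot of row `b` with partner `a`
    rw [hqa, Equiv.swap_apply_left] at hyc
    have e1 : a - Fin.castSucc y - 1 = b := by rw [hyc]; ring
    rw [e1, Equiv.swap_apply_right]
    have e2 : Fin.castSucc ι = b - q - 1 := by rw [hq]; ring
    rw [e2, hqa]
  · rw [Equiv.swap_apply_of_ne_of_ne hqa hqb] at hyc
    have e1 : a - Fin.castSucc y - 1 = q := by rw [hyc]; ring
    rw [e1, Equiv.swap_apply_of_ne_of_ne hqa hqb, hq]
    ring

/-- **`ε((a b)) = (-1)^{D-1}`**: the sign multiplier of a transposition relabelling.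
[cite: BurgisserIkenmeyer2017, Thm. 3.22(2)] -/
theorem prod_sign_cycSlotPerm_swap {R : Type*} [CommRing R] {a b : Fin (D + 1)} (hab : a ≠ b) :
    (∏ j', (Equiv.Perm.sign (cycSlotPerm (Equiv.swap a b) j') : R)) = (-1) ^ (D - 1) := by
  classical
  rw [← Finset.prod_mul_prod_compl ({a, b} : Finset (Fin (D + 1))), Finset.prod_pair hab]
  -- rows `a`, `b`: mutually inverse slot maps, signs multiply to `1`
  have hab1 : (Equiv.Perm.sign (cycSlotPerm (Equiv.swap a b) a) : R) *
      (Equiv.Perm.sign (cycSlotPerm (Equiv.swap a b) b) : R) = 1 := by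
    rw [← Int.cast_mul, ← Units.val_mul, ← map_mul, cycSlotPerm_swap_mul a b, map_one,
      Units.val_one, Int.cast_one]
  rw [hab1, one_mul]
  -- the other `D - 1` rows: transpositions
  have hrest : ∀ j ∈ ({a, b} : Finset (Fin (D + 1)))ᶜ,
      (Equiv.Perm.sign (cycSlotPerm (Equiv.swap a b) j) : R) = -1 := by
    intro j hj
    rw [Finset.mem_compl, Finset.mem_insert, Finset.mem_singleton, not_or] at hj
    rw [cycSlotPerm_swap_of_ne hj.1 hj.2, Equiv.Perm.sign_swap]
    · simp
    · intro h
      apply hab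
      have h1 := congrArg Fin.castSucc h
      rw [castSucc_cycSlotOf, castSucc_cycSlotOf] at h1
      linear_combination -h1
  rw [Finset.prod_congr rfl hrest, Finset.prod_const, Finset.card_compl, Finset.card_pair hab,
    Fintype.card_fin]
  congr 1

end SwapSign

/-! ### Even `D`: `P_D` vanishes on symmetric arrays -/

section EvenVanishing

variable {D : ℕ}

/-- **For even `D ≥ 2`, `P_D` vanishes on every symmetric array** over a commutative ring in
which `2` is a non-zero-divisor: the transposition relabelling is a sign-reversing bijection of
the terms of eq. (3.7). (BI 2017 Thm. 3.22(2), "only if"; the source obtains this from Howe's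
Thm. 3.21 instead.) [cite: BurgisserIkenmeyer2017, Thm. 3.22(2)] -/
theorem tableauInv_cyclicTableau_eq_zero_of_even {R : Type*} [CommRing R] [NoZeroDivisors R]
    [CharZero R] (hD : Even D) (hD0 : 0 < D) (v : (Fin D → Fin D) → R)
    (hv : ∀ (w : Fin D → Fin D) (e : Equiv.Perm (Fin D)), v (w ∘ e) = v w) :
    tableauInv (cyclicTableau D) v = 0 := by
  obtain ⟨D', rfl⟩ := Nat.exists_eq_succ_of_ne_zero hD0.ne'
  have hab : (0 : Fin (D' + 1 + 1)) ≠ 1 := (NeZero.ne (1 : Fin (D' + 1 + 1))).symm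
  have h := tableauInv_cyclicTableau_eq_eps_mul v hv (Equiv.swap 0 1)
  rw [prod_sign_cycSlotPerm_swap hab, Odd.neg_one_pow (Nat.Even.sub_odd le_add_self hD odd_one),
    neg_one_mul] at h
  have h2 : (2 : R) * tableauInv (cyclicTableau (D' + 1)) v = 0 := by
    rw [two_mul]
    nth_rw 2 [h]
    exact add_neg_cancel _
  rcases mul_eq_zero.mp h2 with h2 | h2
  · exact absurd h2 two_ne_zero
  · exact h2

variable {σ k : Type*} [Fintype σ] [DecidableEq σ] [Field k] {m : ℕ}

/-- The generic symmetric array `symArrayPoly` is symmetric in its slots (BI 2017 §3.1, L993: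
forms as symmetric tensors `v : [m]^D → ℂ`). [cite: BurgisserIkenmeyer2017, §3.1] -/
theorem symArrayPoly_comp_perm (t : Fin m → σ) (J : Fin D → Fin m) (e : Equiv.Perm (Fin D)) :
    symArrayPoly (k := k) D t (J ∘ e) = symArrayPoly D t J := by
  have h1 : wordExp (t ∘ (J ∘ e)) = wordExp (t ∘ J) := wordExp_comp_perm (t ∘ J) e
  have h2 : wordDegIdx t (J ∘ e) = wordDegIdx t J := Subtype.ext h1
  rw [symArrayPoly, symArrayPoly, h1, h2]

/-- **BI 2017 Thm. 3.22(2), "only if": for even `D ≥ 2` the polynomial `P_D` on `Sym^D k^D` is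
zero** (characteristic zero). [cite: BurgisserIkenmeyer2017, Thm. 3.22(2)] -/
theorem oddCayleyP_eq_zero_of_even [CharZero k] (hD : Even D) (hD0 : 0 < D) (t : Fin D ≃ σ) :
    oddCayleyP (k := k) D t = 0 := by
  rw [oddCayleyP, tableauInvPoly]
  exact tableauInv_cyclicTableau_eq_zero_of_even hD hD0 _
    fun J e => symArrayPoly_comp_perm (k := k) (t : Fin D → σ) J e

end EvenVanishing

/-! ### Odd `D`: the tuples with `D` constant columns (structure of the `α`-coefficient) -/

section ConstantColumns

open Fin.CommRing

variable {D : ℕ}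

/-- Column `i` of the tuple `σ` is a constant word ("`σ_i(1) = ⋯ = σ_{i+D-1}(D)`", BI 2017 proof
of Thm. 3.22, L1286). [cite: BurgisserIkenmeyer2017, Thm. 3.22 (proof)] -/
def IsCycColConst (σ : Fin (D + 1) → Equiv.Perm (Fin D)) (i : Fin (D + 1)) : Prop :=
  ∀ ι ι' : Fin D, cycColWord σ i ι = cycColWord σ i ι'

/-- All columns except (possibly) the `i`-th are constant: the tuples seen by the coefficient
analysed in the printed proof ("there exists a cardinality `D` subset `I ⊂ {1,…,D+1}` such that
… for all `i ∈ I`", L1285), `i` = the print's `ῑ + 1`. [cite: BurgisserIkenmeyer2017, Thm. 3.22 (proof)] -/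
def AllCycColConstBut (σ : Fin (D + 1) → Equiv.Perm (Fin D)) (i : Fin (D + 1)) : Prop :=
  ∀ i', i' ≠ i → IsCycColConst σ i'

/-- Two permutations that agree at all points but one agree everywhere. [folklore] -/
private theorem perm_eq_of_forall_ne_apply_eq {α : Type*} {f g : Equiv.Perm α} (x₀ : α)
    (h : ∀ x, x ≠ x₀ → f x = g x) : f = g := by
  refine Equiv.ext fun x => ?_
  by_cases hx : x = x₀
  · subst hx
    by_contra hne
    have hy : g.symm (f x) ≠ x := by
      intro hy
      apply hne
      calc f x = g (g.symm (f x)) := (Equiv.apply_symm_apply _ _).symm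
        _ = g x := by rw [hy]
    have h2 := h _ hy
    rw [Equiv.apply_symm_apply] at h2
    exact hy (f.injective h2)
  · exact h x hx

/-- The fixed slot permutations `g_j` of the base configuration (exceptional column `0`, pivot
row `ῑ = -1`): `g_j(ι) = ι - j - 1` for `ι ≠ j`, and `g_j(j) = -j - 2` (values in `ℤ/(D+1) ∖ {-1}`
= the slots). [cite: BurgisserIkenmeyer2017, Thm. 3.22 (proof: "`σ_{ῑ+1}(1) = σ_ῑ(D)`, …")] -/
def baseSlotFun (j : Fin (D + 1)) (ι : Fin D) : Fin D :=
  if h : Fin.castSucc ι = j then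
    Fin.castPred (-1 - j - 1)
      (sub_sub_one_ne_last (by rw [← h]; exact (castSucc_ne_neg_one ι).symm))
  else Fin.castPred (Fin.castSucc ι - j - 1) (sub_sub_one_ne_last h)

/-- The base slot at the exceptional cell, read in `Fin (D + 1)`. [folklore] -/
private theorem castSucc_baseSlotFun_of_eq {j : Fin (D + 1)} {ι : Fin D} (h : Fin.castSucc ι = j) :
    Fin.castSucc (baseSlotFun j ι) = -1 - j - 1 := by
  rw [baseSlotFun, dif_pos h]
  exact Fin.castSucc_castPred _ _

/-- The base slot at a regular cell, read in `Fin (D + 1)`. [folklore] -/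
private theorem castSucc_baseSlotFun_of_ne {j : Fin (D + 1)} {ι : Fin D} (h : Fin.castSucc ι ≠ j) :
    Fin.castSucc (baseSlotFun j ι) = Fin.castSucc ι - j - 1 := by
  rw [baseSlotFun, dif_neg h]
  exact Fin.castSucc_castPred _ _

/-- The base slot map is injective. [folklore] -/
private theorem baseSlotFun_injective (j : Fin (D + 1)) : Function.Injective (baseSlotFun (D := D) j) := by
  intro ι₁ ι₂ h
  have h1 := congrArg Fin.castSucc h
  apply Fin.castSucc_injective
  by_cases h₁ : Fin.castSucc ι₁ = j
  · by_cases h₂ : Fin.castSucc ι₂ = j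
    · rw [h₁, h₂]
    · rw [castSucc_baseSlotFun_of_eq h₁, castSucc_baseSlotFun_of_ne h₂] at h1
      exact absurd (by linear_combination -h1) (castSucc_ne_neg_one ι₂)
  · by_cases h₂ : Fin.castSucc ι₂ = j
    · rw [castSucc_baseSlotFun_of_ne h₁, castSucc_baseSlotFun_of_eq h₂] at h1
      exact absurd (by linear_combination h1) (castSucc_ne_neg_one ι₁)
    · rw [castSucc_baseSlotFun_of_ne h₁, castSucc_baseSlotFun_of_ne h₂] at h1
      linear_combination h1

/-- The base slot permutation `g_j`. [cite: BurgisserIkenmeyer2017, Thm. 3.22 (proof)] -/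
noncomputable def baseSlotPerm (j : Fin (D + 1)) : Equiv.Perm (Fin D) :=
  Equiv.ofBijective (baseSlotFun j) (Finite.injective_iff_bijective.mp (baseSlotFun_injective j))

/-- Unfolding `baseSlotPerm`. [folklore] -/
@[simp] private theorem baseSlotPerm_apply (j : Fin (D + 1)) (ι : Fin D) :
    baseSlotPerm j ι = baseSlotFun j ι :=
  rfl

/-- Off the exceptional column `0`, the base slots are constant along columns: column `i ≠ 0`
meets row `i + ι` in the slot `ι`, and `g_{i+ι}(ι) = -i - 1`. [cite: BurgisserIkenmeyer2017, Thm. 3.22 (proof)] -/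
theorem castSucc_baseSlotFun_col {i : Fin (D + 1)} (hi : i ≠ 0) (ι : Fin D) :
    Fin.castSucc (baseSlotFun (i + Fin.castSucc ι) ι) = -i - 1 := by
  have h : Fin.castSucc ι ≠ i + Fin.castSucc ι := fun h => hi (by linear_combination -h)
  rw [castSucc_baseSlotFun_of_ne h]
  ring

/-- **The tuples `σ_j = ρ ∘ g_j` have all columns `i ≠ 0` constant.**
[cite: BurgisserIkenmeyer2017, Thm. 3.22 (proof)] -/
theorem allCycColConstBut_base (ρ : Equiv.Perm (Fin D)) :
    AllCycColConstBut (fun j => ρ * baseSlotPerm j) 0 := by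
  intro i hi ι ι'
  simp only [cycColWord, Equiv.Perm.mul_apply, baseSlotPerm_apply]
  congr 1
  apply Fin.castSucc_injective
  rw [castSucc_baseSlotFun_col hi, castSucc_baseSlotFun_col hi]

/-- **Structure lemma** (BI 2017, proof of Thm. 3.22, L1290: "all `σ_i` … are completely
determined by `σ_ῑ`"): a tuple whose columns `i ≠ 0` are all constant is `σ_j = σ_{-1} ∘ g_j`.
[cite: BurgisserIkenmeyer2017, Thm. 3.22 (proof)] -/
theorem eq_base_of_allCycColConstBut {σ : Fin (D + 1) → Equiv.Perm (Fin D)}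
    (h : AllCycColConstBut σ 0) : σ = fun j => σ (Fin.last D) * baseSlotPerm j := by
  -- the cells outside the exceptional column: value = value of the pivot row `-1` in the same column
  have key : ∀ (j : Fin (D + 1)) (ι : Fin D), Fin.castSucc ι ≠ j →
      σ j ι = σ (Fin.last D) (baseSlotFun j ι) := by
    intro j ι hι
    have hi : j - Fin.castSucc ι ≠ 0 := fun h0 => hι (by linear_combination -h0)
    have hc := h (j - Fin.castSucc ι) hi ι (baseSlotFun j ι)
    simp only [cycColWord] at hc
    have e1 : j - Fin.castSucc ι + Fin.castSucc ι = j := by ring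
    have e2 : j - Fin.castSucc ι + Fin.castSucc (baseSlotFun j ι) = Fin.last D := by
      rw [castSucc_baseSlotFun_of_ne hι, fin_last_eq_neg_one]
      ring
    rw [e1, e2] at hc
    exact hc
  funext j
  by_cases hj : j = Fin.last D
  · refine Equiv.ext fun ι => ?_
    rw [Equiv.Perm.mul_apply, baseSlotPerm_apply]
    exact key j ι (by rw [hj]; exact Fin.castSucc_ne_last ι)
  · obtain ⟨ι₀, hι₀⟩ := Fin.exists_castSucc_eq.mpr hj
    refine perm_eq_of_forall_ne_apply_eq ι₀ fun ι hne => ?_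
    rw [Equiv.Perm.mul_apply, baseSlotPerm_apply]
    refine key j ι fun hι => hne (Fin.castSucc_injective _ ?_)
    rw [hι, hι₀]

/-- The signed count weight of a tuple: `∏_j sgn σ_j` as an integer.
[cite: BurgisserIkenmeyer2017, eq. (3.7)] -/
def cycSignZ (σ : Fin (D + 1) → Equiv.Perm (Fin D)) : ℤ :=
  ∏ j, ((Equiv.Perm.sign (σ j) : ℤˣ) : ℤ)

open Classical in
/-- The signed number of tuples all of whose columns other than `i₀` are constant.
[cite: BurgisserIkenmeyer2017, Thm. 3.22 (proof)] -/
noncomputable def cycCount (D : ℕ) (i₀ : Fin (D + 1)) : ℤ :=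
  ∑ σ : Fin (D + 1) → Equiv.Perm (Fin D), if AllCycColConstBut σ i₀ then cycSignZ σ else 0

/-- Shifting the rows of a tuple by `i₀` (moves the exceptional column `i₀` to `0`).
[cite: BurgisserIkenmeyer2017, Thm. 3.22(2)] -/
def cycShiftTuple (i₀ : Fin (D + 1)) :
    (Fin (D + 1) → Equiv.Perm (Fin D)) ≃ (Fin (D + 1) → Equiv.Perm (Fin D)) where
  toFun σ := fun j => σ (j + i₀)
  invFun σ := fun j => σ (j - i₀)
  left_inv σ := by funext j; simp
  right_inv σ := by funext j; simp

/-- Columns of the shifted tuple. [folklore] -/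
private theorem cycColWord_cycShiftTuple (i₀ : Fin (D + 1)) (σ : Fin (D + 1) → Equiv.Perm (Fin D))
    (i : Fin (D + 1)) : cycColWord (cycShiftTuple i₀ σ) i = cycColWord σ (i + i₀) := by
  funext ι
  change σ (i + Fin.castSucc ι + i₀) ι = σ (i + i₀ + Fin.castSucc ι) ι
  rw [add_right_comm]

/-- The shift moves the exceptional column to `0`. [folklore] -/
private theorem allCycColConstBut_cycShiftTuple (i₀ : Fin (D + 1))
    (σ : Fin (D + 1) → Equiv.Perm (Fin D)) :
    AllCycColConstBut (cycShiftTuple i₀ σ) 0 ↔ AllCycColConstBut σ i₀ := by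
  constructor
  · intro h i' hi' ι ι'
    have h1 := h (i' - i₀) (fun h0 => hi' (by linear_combination h0)) ι ι'
    rwa [cycColWord_cycShiftTuple, sub_add_cancel] at h1
  · intro h i hi ι ι'
    rw [cycColWord_cycShiftTuple]
    exact h (i + i₀) (fun h0 => hi (by linear_combination h0)) ι ι'

/-- The shift preserves the sign weight. [folklore] -/
private theorem cycSignZ_cycShiftTuple (i₀ : Fin (D + 1)) (σ : Fin (D + 1) → Equiv.Perm (Fin D)) :
    cycSignZ (cycShiftTuple i₀ σ) = cycSignZ σ :=
  Equiv.prod_comp (Equiv.addRight i₀) (fun j => ((Equiv.Perm.sign (σ j) : ℤˣ) : ℤ))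

/-- All exceptional columns `i₀` contribute the same signed count (shift the rows).
[cite: BurgisserIkenmeyer2017, Thm. 3.22 (proof)] -/
theorem cycCount_eq_cycCount_zero (i₀ : Fin (D + 1)) : cycCount D i₀ = cycCount D 0 := by
  classical
  unfold cycCount
  conv_rhs => rw [← Equiv.sum_comp (cycShiftTuple i₀)]
  refine Finset.sum_congr rfl fun σ _ => ?_
  rw [cycSignZ_cycShiftTuple]
  by_cases h : AllCycColConstBut σ i₀
  · rw [if_pos h, if_pos ((allCycColConstBut_cycShiftTuple i₀ σ).mpr h)]
  · rw [if_neg h, if_neg (fun h' => h ((allCycColConstBut_cycShiftTuple i₀ σ).mp h'))]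

/-- The signed count for the exceptional column `0`: `D! · ∏_j sgn g_j` when `D + 1` is even
(the sign of `ρ` enters to the even power `D + 1` — "`(-1)^{D+1} = 1`, since `D + 1` is even",
L1298). [cite: BurgisserIkenmeyer2017, Thm. 3.22 (proof)] -/
theorem cycCount_zero_eq (hD : Odd D) :
    cycCount D 0 = (Nat.factorial D : ℤ) * cycSignZ (fun j => baseSlotPerm (D := D) j) := by
  classical
  unfold cycCount
  rw [← Finset.sum_filter]
  have hS : (Finset.univ.filter fun σ : Fin (D + 1) → Equiv.Perm (Fin D) => AllCycColConstBut σ 0) =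
      Finset.univ.map ⟨fun ρ : Equiv.Perm (Fin D) => fun j => ρ * baseSlotPerm j, fun ρ₁ ρ₂ h => by
        have h1 := congrFun h (Fin.last D)
        have hg : baseSlotPerm (D := D) (Fin.last D) = 1 := by
          refine Equiv.ext fun ι => Fin.castSucc_injective _ ?_
          rw [baseSlotPerm_apply, castSucc_baseSlotFun_of_ne (Fin.castSucc_ne_last ι),
            Equiv.Perm.one_apply, fin_last_eq_neg_one]
          ring
        simpa [hg] using h1⟩ := by
    ext σ
    simp only [Finset.mem_filter, Finset.mem_univ, true_and, Finset.mem_map,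
      Function.Embedding.coeFn_mk]
    constructor
    · intro h
      exact ⟨σ (Fin.last D), (eq_base_of_allCycColConstBut h).symm⟩
    · rintro ⟨ρ, rfl⟩
      exact allCycColConstBut_base ρ
  rw [hS, Finset.sum_map, Function.Embedding.coeFn_mk]
  have hterm : ∀ ρ : Equiv.Perm (Fin D),
      cycSignZ (fun j => ρ * baseSlotPerm j) = cycSignZ (fun j => baseSlotPerm (D := D) j) := by
    intro ρ
    unfold cycSignZ
    simp only [map_mul, Units.val_mul]
    rw [Finset.prod_mul_distrib, Finset.prod_const, Finset.card_univ, Fintype.card_fin]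
    have h1 : (((Equiv.Perm.sign ρ : ℤˣ) : ℤ)) ^ (D + 1) = 1 := by
      rcases Int.units_eq_one_or (Equiv.Perm.sign ρ) with h | h
      · rw [h, Units.val_one, one_pow]
      · rw [h, Units.val_neg, Units.val_one, Even.neg_one_pow hD.add_one]
    rw [h1, one_mul]
  simp_rw [hterm]
  rw [Finset.sum_const, Finset.card_univ, Fintype.card_perm, Fintype.card_fin, nsmul_eq_mul]

/-- The weight `∏_j sgn σ_j` is a unit, in particular nonzero. [folklore] -/
private theorem cycSignZ_ne_zero (σ : Fin (D + 1) → Equiv.Perm (Fin D)) : cycSignZ σ ≠ 0 :=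
  Finset.prod_ne_zero_iff.mpr fun _ _ => Units.ne_zero _

/-- **The `α`-coefficient is nonzero**: `∑_{i₀} cycCount D i₀ = (D + 1) · D! · (±1) ≠ 0` for
odd `D` ("which results in the coefficient being … nonzero", L1300).
[cite: BurgisserIkenmeyer2017, Thm. 3.22 (proof)] -/
theorem sum_cycCount_ne_zero (hD : Odd D) : ∑ i₀ : Fin (D + 1), cycCount D i₀ ≠ 0 := by
  simp_rw [cycCount_eq_cycCount_zero, cycCount_zero_eq hD]
  rw [Finset.sum_const, Finset.card_univ, Fintype.card_fin, nsmul_eq_mul]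
  refine mul_ne_zero (by exact_mod_cast Nat.succ_ne_zero D) (mul_ne_zero ?_ (cycSignZ_ne_zero _))
  exact_mod_cast Nat.factorial_ne_zero D

end ConstantColumns

/-! ### Odd `D`: `P_D` at `α (X_1+⋯+X_D)^D + X_1^D + ⋯ + X_D^D`, as a polynomial in `α` -/

section AlphaPolynomial

variable {D : ℕ}

open Classical in
/-- The array of `α (∑ X_i)^D + ∑ X_i^D` with `α` an indeterminate: `α + [μ constant]`
("`w(μ) = 1 + α` iff `μ_1 = … = μ_D` and `w(μ) = 1` otherwise", L1279, up to the interchange of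
the two values noted in the module docstring). [cite: BurgisserIkenmeyer2017, Thm. 3.22 (proof)] -/
noncomputable def alphaArray (D : ℕ) (w : Fin D → Fin D) : Polynomial ℂ :=
  Polynomial.X + Polynomial.C (if ∀ ι ι' : Fin D, w ι = w ι' then 1 else 0)

/-- `P_D` at the `α`-array: "a polynomial in `α` of degree at most `D + 1`" (L1280).
[cite: BurgisserIkenmeyer2017, Thm. 3.22 (proof)] -/
noncomputable def alphaPoly (D : ℕ) : Polynomial ℂ :=
  tableauInv (cyclicTableau D) (alphaArray D)

/-- **The analysed coefficient of `P_D(w_α)`**: `(d/dα) P_D(w_α) |_{α = 0} = ∑_{i₀} cycCount D i₀`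
— only tuples with `D` constant columns contribute (L1284–1286).
[cite: BurgisserIkenmeyer2017, Thm. 3.22 (proof)] -/
theorem eval_zero_derivative_alphaPoly :
    (Polynomial.derivative (alphaPoly D)).eval 0 = ((∑ i₀ : Fin (D + 1), cycCount D i₀ : ℤ) : ℂ) := by
  classical
  have hsgn : ∀ σ : Fin (D + 1) → Equiv.Perm (Fin D),
      (∏ j, (Equiv.Perm.sign (σ j) : Polynomial ℂ)) = Polynomial.C ((cycSignZ σ : ℤ) : ℂ) := by
    intro σ
    rw [cycSignZ, Int.cast_prod, map_prod]
    refine Finset.prod_congr rfl fun j _ => ?_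
    rw [map_intCast]
  rw [alphaPoly, tableauInv_cyclicTableau]
  simp_rw [hsgn]
  rw [Polynomial.derivative_sum, Polynomial.eval_finsetSum]
  have hterm : ∀ σ : Fin (D + 1) → Equiv.Perm (Fin D),
      Polynomial.eval 0 (Polynomial.derivative
        (Polynomial.C ((cycSignZ σ : ℤ) : ℂ) * ∏ i, alphaArray D (cycColWord σ i))) =
      ∑ i₀, ((if AllCycColConstBut σ i₀ then cycSignZ σ else 0 : ℤ) : ℂ) := by
    intro σ
    rw [Polynomial.derivative_C_mul, Polynomial.derivative_prod_finset, Polynomial.eval_mul,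
      Polynomial.eval_C, Polynomial.eval_finsetSum, Finset.mul_sum]
    refine Finset.sum_congr rfl fun i₀ _ => ?_
    rw [alphaArray, Polynomial.derivative_X_add_C, mul_one, Polynomial.eval_prod]
    have hev : ∀ i ∈ Finset.univ.erase i₀, Polynomial.eval 0 (alphaArray D (cycColWord σ i)) =
        if ∀ ι ι' : Fin D, cycColWord σ i ι = cycColWord σ i ι' then 1 else 0 := by
      intro i _
      rw [alphaArray, Polynomial.eval_add, Polynomial.eval_X, Polynomial.eval_C, zero_add]
    rw [Finset.prod_congr rfl hev, Finset.prod_boole]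
    have hiff : (∀ i ∈ Finset.univ.erase i₀, ∀ ι ι' : Fin D, cycColWord σ i ι = cycColWord σ i ι') ↔
        AllCycColConstBut σ i₀ := by
      simp only [Finset.mem_erase, Finset.mem_univ, and_true]
      rfl
    by_cases h : AllCycColConstBut σ i₀
    · rw [if_pos (hiff.mpr h), if_pos h, mul_one]
    · rw [if_neg (fun h' => h (hiff.mp h')), if_neg h, mul_zero, Int.cast_zero]
  rw [Finset.sum_congr rfl fun σ _ => hterm σ, Finset.sum_comm, Int.cast_sum]
  refine Finset.sum_congr rfl fun i₀ _ => ?_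
  rw [cycCount, Int.cast_sum]

/-- **`P_D(w_α)` is not the zero polynomial in `α`** for odd `D`.
[cite: BurgisserIkenmeyer2017, Thm. 3.22 (proof)] -/
theorem alphaPoly_ne_zero (hD : Odd D) : alphaPoly D ≠ 0 := by
  intro h
  have h1 := eval_zero_derivative_alphaPoly (D := D)
  rw [h, Polynomial.derivative_zero, Polynomial.eval_zero] at h1
  exact sum_cycCount_ne_zero hD (by exact_mod_cast h1.symm)

/-- Hence some `α ∈ ℂ` has `P_D(w_α) ≠ 0`. [cite: BurgisserIkenmeyer2017, Thm. 3.22 (proof)] -/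
theorem exists_eval_alphaPoly_ne_zero (hD : Odd D) : ∃ α : ℂ, (alphaPoly D).eval α ≠ 0 := by
  by_contra h
  push Not at h
  refine alphaPoly_ne_zero hD (Polynomial.eq_zero_of_infinite_isRoot _ ?_)
  have hall : {x : ℂ | (alphaPoly D).IsRoot x} = Set.univ := Set.eq_univ_of_forall fun x => h x
  rw [hall]
  exact Set.infinite_univ

end AlphaPolynomial

/-! ### Odd `D`: back to forms — `P_D ≠ 0` -/

section OddNonvanishing

variable {σ k : Type*} [Fintype σ] [DecidableEq σ] [Field k] {D : ℕ}

/-- The array of a sum of forms is the sum of the arrays (arrays of forms = symmetric tensors,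
BI 2017 §3.1, L993). [cite: BurgisserIkenmeyer2017, §3.1] -/
theorem arrOf_add (p q : MvPolynomial σ k) (J : Fin D → σ) :
    arrOf D (p + q) J = arrOf D p J + arrOf D q J := by
  rw [arrOf, arrOf, arrOf, coeff_add, add_div]

/-- The array of a scalar multiple of a form (BI 2017 §3.1, L993). [cite: BurgisserIkenmeyer2017, §3.1] -/
theorem arrOf_C_mul (a : k) (q : MvPolynomial σ k) (J : Fin D → σ) :
    arrOf D (C a * q) J = a * arrOf D q J := by
  rw [arrOf, arrOf, coeff_C_mul, mul_div_assoc]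

/-- **The array of `(X_1 + ⋯ + X_D)^D` is identically `1`** (the tensor
`|(1+2+⋯+D)⋯(1+2+⋯+D)⟩ = ∑_μ |μ⟩`, L1276). [cite: BurgisserIkenmeyer2017, Thm. 3.22 (proof)] -/
theorem arrOf_sum_X_pow [CharZero k] (J : Fin D → Fin D) :
    arrOf D ((∑ i : Fin D, X i : MvPolynomial (Fin D) k) ^ D) J = 1 := by
  classical
  have h : ((∑ i : Fin D, X i : MvPolynomial (Fin D) k) ^ D) =
      ∑ I : Fin D → Fin D, C (1 : k) * ∏ j, X (I j) := by
    simp_rw [map_one, one_mul]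
    rw [← Fintype.prod_sum (fun (_ : Fin D) (i : Fin D) => (X i : MvPolynomial (Fin D) k)),
      Finset.prod_const, Finset.card_univ, Fintype.card_fin]
  rw [h, arrOf_sum_C_mul_prod_X (fun _ _ => rfl)]

/-- **The array of `X_1^D + ⋯ + X_D^D` is the indicator of the constant words** (the tensor
`∑_i |i⋯i⟩`, L1276). [cite: BurgisserIkenmeyer2017, Thm. 3.22 (proof)] -/
theorem arrOf_sum_X_pow_self (hD : 0 < D) (J : Fin D → Fin D) :
    arrOf D (∑ i : Fin D, X i ^ D : MvPolynomial (Fin D) k) J =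
      if ∀ ι ι' : Fin D, J ι = J ι' then 1 else 0 := by
  classical
  have hc := coeff_wordExp_sum_X_pow (k := k) (t := (id : Fin D → Fin D))
    Function.injective_id hD J
  simp only [Function.id_comp, id] at hc
  rw [arrOf, hc]
  by_cases hJ : ∀ ι ι' : Fin D, J ι = J ι'
  · have hJ' : ∀ j, J j = J ⟨0, hD⟩ := fun j => hJ j _
    have hJf : J = fun _ => J ⟨0, hD⟩ := funext hJ'
    rw [if_pos hJ', if_pos hJ]
    conv_lhs => rw [hJf]
    rw [card_filter_wordExp_const, Nat.cast_one, div_one]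
  · have hJ' : ¬ ∀ j, J j = J ⟨0, hD⟩ := fun h => hJ fun ι ι' => (h ι).trans (h ι').symm
    rw [if_neg hJ', if_neg hJ, zero_div]

/-- The array of `w_α = α (∑ X_i)^D + ∑ X_i^D` is the `α`-array evaluated at `α`.
[cite: BurgisserIkenmeyer2017, Thm. 3.22 (proof)] -/
theorem arrOf_alphaForm (hD : 0 < D) (α : ℂ) (J : Fin D → Fin D) :
    arrOf D (C α * (∑ i : Fin D, X i : MvPolynomial (Fin D) ℂ) ^ D + ∑ i : Fin D, X i ^ D) J =
      (alphaArray D J).eval α := by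
  classical
  rw [arrOf_add, arrOf_C_mul, arrOf_sum_X_pow, arrOf_sum_X_pow_self hD, mul_one, alphaArray,
    Polynomial.eval_add, Polynomial.eval_X, Polynomial.eval_C]

/-- **BI 2017 Thm. 3.22(2), "if": for odd `D` the polynomial `P_D` is nonzero**, witnessed by
`w_α = α (X_1+⋯+X_D)^D + X_1^D+⋯+X_D^D` for a suitable `α ∈ ℂ` (printed proof, L1275–1300).
[cite: BurgisserIkenmeyer2017, Thm. 3.22(2)] -/
theorem oddCayleyP_ne_zero_of_odd (hD : Odd D) :
    oddCayleyP (k := ℂ) D (Equiv.refl (Fin D)) ≠ 0 := by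
  classical
  obtain ⟨α, hα⟩ := exists_eval_alphaPoly_ne_zero hD
  intro h0
  apply hα
  set w : MvPolynomial (Fin D) ℂ :=
    C α * (∑ i : Fin D, X i : MvPolynomial (Fin D) ℂ) ^ D + ∑ i : Fin D, X i ^ D with hw
  have h1 := aeval_formCoeff_tableauInvPoly (k := ℂ) (cyclicTableau D)
    ((Equiv.refl (Fin D) : Fin D ≃ Fin D) : Fin D → Fin D) w
  rw [show tableauInvPoly (k := ℂ) D (cyclicTableau D)
      ((Equiv.refl (Fin D) : Fin D ≃ Fin D) : Fin D → Fin D) = oddCayleyP D (Equiv.refl (Fin D))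
      from rfl, h0, map_zero] at h1
  have harr : (fun J : Fin D → Fin D => arrOf D w ((Equiv.refl (Fin D) : Fin D → Fin D) ∘ J)) =
      fun J => Polynomial.evalRingHom α (alphaArray D J) := by
    funext J
    rw [Equiv.coe_refl, Function.id_comp, hw, arrOf_alphaForm hD.pos α J]
    rfl
  rw [harr, ← map_tableauInv (Polynomial.evalRingHom α)] at h1
  rw [alphaPoly]
  exact h1.symm

end OddNonvanishing

/-! ### The discharge -/

/-- **BI 2017, Thm. 3.22 DISCHARGED**: (1) `P_D(gv) = (det g)^{D+1} P_D(v)` (the cyclic-tableau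
case of Thm. 3.11, `BI2017_thm_3_22_1`); (2) for `D ≥ 1`, `P_D ≠ 0` iff `D` is odd
(`oddCayleyP_ne_zero_of_odd`, `oddCayleyP_eq_zero_of_even`).
[cite: BurgisserIkenmeyer2017, Thm. 3.22] -/
theorem BI2017_thm_3_22_holds : BI2017_thm_3_22 := by
  refine ⟨fun R _ D g v => BI2017_thm_3_22_1 D g v, fun D hD => ⟨fun hne => ?_, fun hodd => ?_⟩⟩
  · by_contra hodd
    exact hne (oddCayleyP_eq_zero_of_even (Nat.not_odd_iff_even.mp hodd) hD _)
  · exact oddCayleyP_ne_zero_of_odd hodd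

end Literature.Computability.AlgebraicComplexity
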